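import Literature.NumberTheory.QuadraticFields.TwistedDedekindZeta
import Literature.NumberTheory.QuadraticFields.LatticeSumPrincipal
import Literature.NumberTheory.QuadraticFields.BakerLimitFormulaMain
import Literature.NumberTheory.QuadraticFields.BakerLimitFormulaBesselBound
import Literature.NumberTheory.QuadraticFields.BakerLimitFormulaBesselLimit
import Literature.NumberTheory.QuadraticFields.BakerLimitFormulaCharSums
import HarnessLib

/-!
# Baker's limit formula (2) for class number one and `k = pq`

Topic `NumberTheory/QuadraticFields`, namespace `Literature.NumberTheory.QuadraticFields.BakerLimitFormula`.
Everything here is PROVED (theorems only, no named facts).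

A. Baker, *Transcendental Number Theory* (1975), Ch. 5 §3 eq. (2) with §4 (pp. 49–51 of the held
copy): for `−d < 0` and `k > 0` coprime discriminants, `χ = (k/·)`, `χ' = (−d/·)`,
"`L(1, χ) L(1, χχ') = (π²/6) ∏_{p∣k} (1 − p^{−2}) Σ_f χ(a)/a + Σ_f Σ_r A_r e^{πirb/(ka)}`", with
`A_0 = 0` unless `k` is a prime power and `|A_r| ≤ (2π/√d)|r| e^{−π|r|√d/(ka)}`, so that for class
number one (one form `f = x² + xy + ¼(1+d)y²`, `a = 1`) and `√d > k`: the double sum is at most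
`16π e^{−π√d/k}/√d` (§4). We prove this in the following form (`baker_limit_formula`): for an
imaginary quadratic field `K` with odd discriminant `d_K < −4` and `𝓞 K` principal, and distinct odd
primes `p, q ∤ d_K`,

`L(1, (·/pq)) · L(1, (·/pq|d_K|)) = (π²/6)(1 − p^{−2})(1 − q^{−2}) + B`,
`|B| ≤ (16π/√|d_K|) e^{−π√|d_K|/(pq)}` provided `e^{−π√|d_K|/(pq)} ≤ ½`,

assembling `TwistedDedekindZeta` (identity (1) through ideals), `LatticeSumPrincipal` (ideals ↔
lattice points, class number one), `BakerLimitFormulaLines/Main/BesselBound/BesselLimit` (the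
Fourier–Bessel expansion, `A_0 = 0`, the bound, the limit `s → 1⁺`) and `BakerLimitFormulaCharSums`
(the line character sums are Ramanujan sums).

## References

* [Baker1975] A. Baker, *Transcendental Number Theory* (1975), Ch. 5 §§2–4 (pp. 48–51).
-/

noncomputable section

open Filter Topology Real Complex Module NumberField Ideal
open Literature.Barriers.RiemannHypothesis Literature.NumberTheory.QuadraticFields.Quadratic
open scoped NumberTheorySymbols

namespace Literature.NumberTheory.QuadraticFields.BakerLimitFormula

/-! ## The weight `w = ψ ∘ f` -/

section Weight

variable {k : ℕ} (ψ : DirichletCharacter ℂ k) (t m : ℤ)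

/-- The weight `w(x, y) = ψ(x² + txy − my²)`. [cite: Baker1975, Ch. 5 §2] -/
theorem norm_weight_le (p : ℤ × ℤ) :
    ‖ψ ((p.1 ^ 2 + t * p.1 * p.2 - m * p.2 ^ 2 : ℤ) : ZMod k)‖ ≤ 1 :=
  DirichletCharacter.norm_le_one ψ _

/-- `w(−x, −y) = w(x, y)`. [folklore] -/
theorem weight_neg (p : ℤ × ℤ) :
    ψ (((-p).1 ^ 2 + t * (-p).1 * (-p).2 - m * (-p).2 ^ 2 : ℤ) : ZMod k) =
      ψ ((p.1 ^ 2 + t * p.1 * p.2 - m * p.2 ^ 2 : ℤ) : ZMod k) := by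
  simp only [Prod.fst_neg, Prod.snd_neg]
  congr 2
  ring

/-- `w(x + k, y) = w(x, y)`. [cite: Baker1975, Ch. 5 §2] -/
theorem weight_add_modulus (x y : ℤ) :
    ψ ((((x + k) ^ 2 + t * (x + k) * y - m * y ^ 2 : ℤ)) : ZMod k) =
      ψ (((x ^ 2 + t * x * y - m * y ^ 2 : ℤ)) : ZMod k) := by
  congr 1
  have : ((x + k) ^ 2 + t * (x + k) * y - m * y ^ 2 : ℤ) =
      (x ^ 2 + t * x * y - m * y ^ 2) + k * (2 * x + k + t * y) := by ring
  have hk : ((k : ℤ) : ZMod k) = 0 := by rw [Int.cast_natCast, ZMod.natCast_self]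
  rw [this, Int.cast_add, Int.cast_mul, hk, zero_mul, add_zero]

end Weight

/-! ## The line character sums for `ψ = (· / pq)` -/

/-- **The line character sums of `ψ = (·/pq)` are the Ramanujan products `c_p(y) c_q(y)`**
(`BakerLimitFormulaCharSums.sum_jacobiSym_bqf_eq`, cast to `ℂ`). [cite: Baker1975, Ch. 5 §3] -/
theorem lineCharSum_jacobiChar {p q : ℕ} [Fact p.Prime] [Fact q.Prime] (hp2 : p ≠ 2) (hq2 : q ≠ 2)
    (hpq : p ≠ q) {t m : ℤ} (hDp : ((t ^ 2 + 4 * m : ℤ) : ZMod p) ≠ 0)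
    (hDq : ((t ^ 2 + 4 * m : ℤ) : ZMod q) ≠ 0) (y : ℤ) :
    haveI : NeZero (p * q) := ⟨mul_ne_zero (Fact.out : p.Prime).ne_zero (Fact.out : q.Prime).ne_zero⟩
    lineCharSum (fun r : ℤ × ℤ => jacobiChar (p * q) ((r.1 ^ 2 + t * r.1 * r.2 - m * r.2 ^ 2 : ℤ) : ZMod (p * q)))
      (p * q) y =
      (if (p : ℤ) ∣ y then (p : ℂ) - 1 else -1) * (if (q : ℤ) ∣ y then (q : ℂ) - 1 else -1) := by
  haveI : NeZero (p * q) := ⟨mul_ne_zero (Fact.out : p.Prime).ne_zero (Fact.out : q.Prime).ne_zero⟩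
  unfold lineCharSum
  simp_rw [jacobiChar_intCast]
  rw [← Int.cast_sum, sum_jacobiSym_bqf_eq hp2 hq2 hpq hDp hDq y]
  push_cast
  split_ifs <;> simp

/-! ## The line `y = 0`: `Σ_{x≠0} ψ(x²) (x²)^{−s} = 2 L(2s, ψ²)` -/

/-- **The line `y = 0`** of the twisted Epstein zeta function of `x² + txy − my²`:
`Σ_{x∈ℤ} w(x, 0) f(x, 0)^{−s} = 2 Σ_{n≥1} ψ(n)² n^{−2s}` (`Re s > 1`). [cite: Baker1975, Ch. 5 §2] -/
theorem tsum_line_zero_eq {k : ℕ} [NeZero k] (ψ : DirichletCharacter ℂ k) {t m : ℤ}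
    (hD : t ^ 2 + 4 * m < 0) {s : ℂ} (hs : 1 < s.re) :
    ∑' x : ℤ, twistTerm (fun r : ℤ × ℤ => ψ ((r.1 ^ 2 + t * r.1 * r.2 - m * r.2 ^ 2 : ℤ) : ZMod k))
        1 t (-m) s (x, 0) = 2 * LSeries (fun n => ψ n ^ 2) (2 * s) := by
  set w : ℤ × ℤ → ℂ := fun r => ψ ((r.1 ^ 2 + t * r.1 * r.2 - m * r.2 ^ 2 : ℤ) : ZMod k) with hw
  have hpos := isPosDefForm_one hD
  obtain ⟨-, -, hline⟩ := twistZeta_eq_tsum_lines hpos (norm_weight_le ψ t m) hs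
  have heven : Function.Even fun x : ℤ => twistTerm w 1 t (-m) s (x, 0) := by
    intro x
    simp only [twistTerm]
    have h1 := epsteinTerm_neg_neg (1 : ℝ) t (-m) s x 0
    rw [neg_zero] at h1
    rw [h1]
    congr 1
    have h2 := weight_neg ψ t m (x, 0)
    simp only [Prod.neg_mk, neg_zero] at h2
    exact h2
  rw [tsum_int_eq_zero_add_two_mul_tsum_pnat heven (hline 0)]
  have h0 : twistTerm w 1 t (-m) s ((0 : ℤ), 0) = 0 := by
    simp only [twistTerm, epsteinTerm, Prod.mk_zero_zero, if_true, mul_zero]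
  rw [h0, zero_add, nsmul_eq_mul, Nat.cast_ofNat,
    tsum_pnat_eq_tsum_succ (f := fun n : ℕ => twistTerm w 1 t (-m) s ((n : ℤ), 0))]
  congr 1
  -- compare with the `L`-series termwise
  have hS : LSeriesSummable (fun n => ψ n ^ 2) (2 * s) := by
    refine LSeriesSummable_of_bounded_of_one_lt_re (m := 1) (fun n _ => ?_) (by simp; linarith)
    rw [norm_pow]
    exact pow_le_one₀ (norm_nonneg _) (DirichletCharacter.norm_le_one ψ _)
  rw [LSeries, hS.tsum_eq_zero_add, LSeries.term_zero, zero_add]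
  refine tsum_congr fun n => ?_
  have hn0 : ((((n + 1 : ℕ) : ℤ), (0 : ℤ)) : ℤ × ℤ) ≠ 0 := fun h => by
    have := congrArg Prod.fst h; simp at this; omega
  rw [LSeries.term_of_ne_zero (Nat.succ_ne_zero n)]
  simp only [twistTerm, hw, epsteinTerm, Nat.cast_succ]
  rw [if_neg (by exact_mod_cast hn0)]
  have e1 : bqfEval 1 (t : ℝ) (-m : ℝ) (((n : ℤ) + 1), 0) = ((((n + 1 : ℕ) : ℤ) : ℝ) ^ 2 : ℝ) := by
    unfold bqfEval; push_cast; ring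
  rw [e1, sq_succ_cpow_neg]
  push_cast
  have e2 : ((n : ZMod k) + 1) ^ 2 + (t : ZMod k) * ((n : ZMod k) + 1) * 0 - (m : ZMod k) * 0 =
      ((n : ZMod k) + 1) ^ 2 := by ring
  rw [e2, map_pow]
  ring

/-! ## The identity for `Re s > 1` -/

section Identity

variable {K : Type*} [Field K] [NumberField K]

/-- **Baker's (1)–(2) before the limit, for class number one and `k = pq`**: for `K` imaginary
quadratic with odd `d_K < −4`, `𝓞 K` principal, an integral basis `(1, ω)` with `ω² = m + tω`,
distinct odd primes `p, q ∤ d_K`, `ψ = (·/pq)`, and real... rather complex `s` with `Re s > 1`: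
`L(s, ψ) L(s, ψχ_{d_K}) = L(2s, ψ²) + Σ_{y≥1} mainPart_y(s) + Σ_{y≥1} besselPart_y(s)`
(for the weight `w = ψ ∘ f`, `f = x² + txy − my²`, `a = 1`, `k = pq`), the two series being summable.
[cite: Baker1975, Ch. 5 §§2–3] -/
theorem LSeries_mul_LSeries_eq (h2 : finrank ℚ K = 2) (hodd : Odd (NumberField.discr K))
    [IsPrincipalIdealRing (𝓞 K)] (b : Basis (Fin 2) ℤ (𝓞 K)) (hb : b 0 = 1) {t m : ℤ}
    (hω : b 1 * b 1 = (m : 𝓞 K) + (t : 𝓞 K) * b 1) (hD : t ^ 2 + 4 * m < -4)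
    {p q : ℕ} [Fact p.Prime] [Fact q.Prime] (hp2 : p ≠ 2) (hq2 : q ≠ 2) (hpq : p ≠ q)
    (hDp : ((t ^ 2 + 4 * m : ℤ) : ZMod p) ≠ 0) (hDq : ((t ^ 2 + 4 * m : ℤ) : ZMod q) ≠ 0)
    {s : ℂ} (hs : 1 < s.re) :
    haveI : NeZero (p * q) := ⟨mul_ne_zero (Fact.out : p.Prime).ne_zero (Fact.out : q.Prime).ne_zero⟩
    let ψ : DirichletCharacter ℂ (p * q) := jacobiChar (p * q)
    let w : ℤ × ℤ → ℂ := fun r => ψ ((r.1 ^ 2 + t * r.1 * r.2 - m * r.2 ^ 2 : ℤ) : ZMod (p * q))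
    Summable (fun y : ℕ => mainPart w 1 t (-m) (p * q) s ((y + 1 : ℕ) : ℤ)) ∧
    Summable (fun y : ℕ => besselPart w 1 t (-m) (p * q) s ((y + 1 : ℕ) : ℤ)) ∧
    LSeries (fun n => ψ n) s * LSeries (fun n => ψ n * jacobiChar (NumberField.discr K).natAbs n) s =
      LSeries (fun n => ψ n ^ 2) (2 * s) + ∑' y : ℕ, mainPart w 1 t (-m) (p * q) s ((y + 1 : ℕ) : ℤ) +
        ∑' y : ℕ, besselPart w 1 t (-m) (p * q) s ((y + 1 : ℕ) : ℤ) := by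
  haveI : NeZero (p * q) := ⟨mul_ne_zero (Fact.out : p.Prime).ne_zero (Fact.out : q.Prime).ne_zero⟩
  intro ψ w
  have hp0 : 0 < p := (Fact.out : p.Prime).pos
  have hq0 : 0 < q := (Fact.out : q.Prime).pos
  have hk : 0 < p * q := mul_pos hp0 hq0
  have hcop : p.Coprime q := (Nat.coprime_primes Fact.out Fact.out).mpr hpq
  have hD0 : t ^ 2 + 4 * m < 0 := by linarith
  have hpos := isPosDefForm_one hD0
  have hw : ∀ r, ‖w r‖ ≤ 1 := norm_weight_le ψ t m
  have hsym : ∀ r, w (-r) = w r := weight_neg ψ t m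
  -- (1): `L L = Σ_𝔞 = ½ Σ'`
  have h1 := tsum_twist_eq_LSeries_mul_LSeries h2 hodd ψ hs
  have h1' := tsum_ideal_eq_half_twistZeta b hb hω hD ψ hs
  -- lines
  obtain ⟨hZ, hlines⟩ := twistZeta_eq_line_zero_add hpos hw hsym hs
  have hline : ∀ y : ℕ, ∑' x : ℤ, twistTerm w 1 t (-m) s (x, ((y + 1 : ℕ) : ℤ)) =
      mainPart w 1 t (-m) (p * q) s ((y + 1 : ℕ) : ℤ) + besselPart w 1 t (-m) (p * q) s ((y + 1 : ℕ) : ℤ) :=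
    fun y => tsum_twistLine_eq_mainPart_add_besselPart hpos hw (by positivity)
      (fun x => weight_add_modulus ψ t m x _) hs
  have hc := lineCharSum_jacobiChar hp2 hq2 hpq hDp hDq (t := t) (m := m)
  have hmain := hasSum_mainPart hpos hp0 hq0 hcop (w := w) (fun y => hc _) hs
  have hsumM : Summable fun y : ℕ => mainPart w 1 t (-m) (p * q) s ((y + 1 : ℕ) : ℤ) := hmain.summable
  have hsumB : Summable fun y : ℕ => besselPart w 1 t (-m) (p * q) s ((y + 1 : ℕ) : ℤ) := by
    have := hlines.sub hsumM
    refine this.congr fun y => ?_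
    rw [hline y]; ring
  refine ⟨hsumM, hsumB, ?_⟩
  rw [← h1, h1', hZ, tsum_line_zero_eq ψ hD0 hs, tsum_congr hline, hsumM.tsum_add hsumB]
  ring

end Identity

/-! ## The limit `s → 1⁺`: Baker's formula (2) -/

section Limit

variable {K : Type*} [Field K] [NumberField K]

omit [NumberField K] in
/-- With `ω² = m + tω` for an integral basis `(1, ω)`: `d_K = t² + 4m`. [folklore] -/
theorem discr_eq_of_basis (b : Basis (Fin 2) ℤ (𝓞 K)) (hb : b 0 = 1) {t m : ℤ}
    (hω : b 1 * b 1 = (m : 𝓞 K) + (t : 𝓞 K) * b 1) [NumberField K] :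
    NumberField.discr K = t ^ 2 + 4 * m := by
  have h := basis_one_mul_self_eq b hb
  have h' : (m : 𝓞 K) + (t : 𝓞 K) * b 1 =
      (b.repr (b 1 * b 1) 0 : 𝓞 K) + (b.repr (b 1 * b 1) 1 : 𝓞 K) * b 1 := hω.symm.trans h
  obtain ⟨hm, ht⟩ := intCast_add_intCast_mul_inj b hb h'
  rw [discr_eq_sq_add_four_mul b hb, ← hm, ← ht]

/-- `ψ(n)² = 𝟙(n)` for the Jacobi character `ψ = (·/k)` and the trivial character `𝟙` modulo `k`.
[folklore] -/
theorem jacobiChar_sq_natCast {k : ℕ} [NeZero k] (n : ℕ) :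
    jacobiChar k n ^ 2 = (1 : DirichletCharacter ℂ k) n := by
  by_cases hu : IsUnit (n : ZMod k)
  · obtain ⟨u, hu⟩ := hu
    rw [← hu, MulChar.one_apply_coe]
    have hne : jacobiChar k u ≠ 0 := (u.isUnit.map (jacobiChar k)).ne_zero
    rcases jacobiChar_trichotomy (q := k) (u : ZMod k) with h | h | h
    · exact absurd h hne
    · rw [h]; norm_num
    · rw [h]; norm_num
  · rw [MulChar.map_nonunit _ hu, MulChar.map_nonunit _ hu]; norm_num

/-- **Baker's limit formula (2) for class number one and `k = pq`.** Let `K` be an imaginary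
quadratic field with odd discriminant `d_K = t² + 4m < −4` (`(1, ω)` an integral basis,
`ω² = m + tω`) and `𝓞 K` principal, and let `p ≠ q` be odd primes not dividing `d_K`. Then with
`ψ = (·/pq)` and `ψχ_{d_K} = (·/pq|d_K|)`,
`L(1, ψ) L(1, ψχ_{d_K}) = L(2, 𝟙_{pq}) + Σ_{y≥1} besselPart_y(1)`,
where `L(2, 𝟙_{pq}) = (1 − p^{−2})(1 − q^{−2}) π²/6` and `|Σ_y besselPart_y(1)| ≤ (16π/√|d_K|) e^{−π√|d_K|/(pq)}`
when `e^{−π√|d_K|/(pq)} ≤ ½` (`norm_tsum_besselPart_one_le_of_le_half` with `a = 1`, `C = 1`,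
`κ = √|d_K|/2`) — Baker's "`|h log ε − (32/21) π√d|`-inequality before inserting the class number
formulas" (§4). Proof: the identity `LSeries_mul_LSeries_eq` on `(1, ∞)` and the limits `s → 1⁺`
(`tendsto_tsum_mainPart`, `tendsto_tsum_besselPart`, continuity of the `L`-functions).
[cite: Baker1975, Ch. 5 §3 eq. (2) and §4] -/
theorem baker_limit_formula (h2 : finrank ℚ K = 2) (hodd : Odd (NumberField.discr K))
    [IsPrincipalIdealRing (𝓞 K)] (b : Basis (Fin 2) ℤ (𝓞 K)) (hb : b 0 = 1) {t m : ℤ}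
    (hω : b 1 * b 1 = (m : 𝓞 K) + (t : 𝓞 K) * b 1) (hD : t ^ 2 + 4 * m < -4)
    {p q : ℕ} [Fact p.Prime] [Fact q.Prime] (hp2 : p ≠ 2) (hq2 : q ≠ 2) (hpq : p ≠ q)
    (hDp : ((t ^ 2 + 4 * m : ℤ) : ZMod p) ≠ 0) (hDq : ((t ^ 2 + 4 * m : ℤ) : ZMod q) ≠ 0) :
    haveI : NeZero (p * q) := ⟨mul_ne_zero (Fact.out : p.Prime).ne_zero (Fact.out : q.Prime).ne_zero⟩
    haveI : NeZero (p * q * (NumberField.discr K).natAbs) :=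
      ⟨mul_ne_zero (mul_ne_zero (Fact.out : p.Prime).ne_zero (Fact.out : q.Prime).ne_zero)
        (Int.natAbs_ne_zero.mpr (NumberField.discr_ne_zero K))⟩
    let ψ : DirichletCharacter ℂ (p * q) := jacobiChar (p * q)
    let w : ℤ × ℤ → ℂ := fun r => ψ ((r.1 ^ 2 + t * r.1 * r.2 - m * r.2 ^ 2 : ℤ) : ZMod (p * q))
    ψ.LFunction 1 * (jacobiChar (p * q * (NumberField.discr K).natAbs)).LFunction 1 =
      (1 : DirichletCharacter ℂ (p * q)).LFunction 2 +
        ∑' y : ℕ, besselPart w 1 t (-m) (p * q) 1 ((y + 1 : ℕ) : ℤ) := by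
  haveI : NeZero (p * q) := ⟨mul_ne_zero (Fact.out : p.Prime).ne_zero (Fact.out : q.Prime).ne_zero⟩
  haveI : NeZero (p * q * (NumberField.discr K).natAbs) :=
    ⟨mul_ne_zero (mul_ne_zero (Fact.out : p.Prime).ne_zero (Fact.out : q.Prime).ne_zero)
      (Int.natAbs_ne_zero.mpr (NumberField.discr_ne_zero K))⟩
  intro ψ w
  set χ' : DirichletCharacter ℂ (p * q * (NumberField.discr K).natAbs) :=
    jacobiChar (p * q * (NumberField.discr K).natAbs) with hχ'
  have hp0 : 0 < p := (Fact.out : p.Prime).pos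
  have hq0 : 0 < q := (Fact.out : q.Prime).pos
  have hk : 0 < p * q := mul_pos hp0 hq0
  have hcop : p.Coprime q := (Nat.coprime_primes Fact.out Fact.out).mpr hpq
  have hD0 : t ^ 2 + 4 * m < 0 := by linarith
  have hpos := isPosDefForm_one hD0
  have hw : ∀ r, ‖w r‖ ≤ 1 := norm_weight_le ψ t m
  have hdisc : NumberField.discr K = t ^ 2 + 4 * m := discr_eq_of_basis b hb hω
  -- the characters are non-trivial
  have hsqD : Squarefree (NumberField.discr K).natAbs := by
    rcases isFundamentalDiscriminant_discr (K := K) h2 with ⟨-, hsq, -⟩ | ⟨h4, -, -⟩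
    · exact Int.squarefree_natAbs.mpr hsq
    · exfalso; rw [Int.odd_iff] at hodd; omega
  have hpq1 : 1 < p * q := Nat.one_lt_mul_iff.mpr ⟨hp0, hq0, Or.inl (Fact.out : p.Prime).one_lt⟩
  have hsqpq : Squarefree (p * q) :=
    Nat.squarefree_mul_iff.mpr ⟨hcop, (Fact.out : p.Prime).squarefree, (Fact.out : q.Prime).squarefree⟩
  have hψ : ψ ≠ 1 := by
    refine jacobiChar_ne_one ?_ hsqpq hpq1.ne'
    exact Nat.odd_mul.mpr ⟨(Fact.out : p.Prime).odd_of_ne_two hp2, (Fact.out : q.Prime).odd_of_ne_two hq2⟩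
  have hpD : ¬ p ∣ (NumberField.discr K).natAbs := fun h => hDp (by
    rw [← hdisc, ZMod.intCast_zmod_eq_zero_iff_dvd]; exact Int.natCast_dvd.mpr h)
  have hqD : ¬ q ∣ (NumberField.discr K).natAbs := fun h => hDq (by
    rw [← hdisc, ZMod.intCast_zmod_eq_zero_iff_dvd]; exact Int.natCast_dvd.mpr h)
  have hχ'ne : χ' ≠ 1 := by
    refine jacobiChar_ne_one ?_ ?_ ?_
    · exact Nat.odd_mul.mpr ⟨Nat.odd_mul.mpr ⟨(Fact.out : p.Prime).odd_of_ne_two hp2,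
        (Fact.out : q.Prime).odd_of_ne_two hq2⟩, Int.natAbs_odd.mpr hodd⟩
    · have hc : (p * q).Coprime (NumberField.discr K).natAbs :=
        Nat.Coprime.mul_left ((Nat.Prime.coprime_iff_not_dvd Fact.out).mpr hpD)
          ((Nat.Prime.coprime_iff_not_dvd Fact.out).mpr hqD)
      exact Nat.squarefree_mul_iff.mpr ⟨hc, hsqpq, hsqD⟩
    · have h0 : 0 < (NumberField.discr K).natAbs := Int.natAbs_pos.mpr (NumberField.discr_ne_zero K)
      have : 1 < p * q * (NumberField.discr K).natAbs :=
        lt_of_lt_of_le hpq1 (Nat.le_mul_of_pos_right _ h0)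
      exact this.ne' 
  -- the product character
  have hprod : ∀ n : ℕ, ψ n * jacobiChar (NumberField.discr K).natAbs n = χ' n := fun n =>
    (jacobiChar_mul_jacobiChar_natCast n).trans rfl
  -- the identity on `(1, ∞)`
  have heq : ∀ s : ℝ, 1 < s →
      ψ.LFunction s * χ'.LFunction s = (1 : DirichletCharacter ℂ (p * q)).LFunction (2 * s) +
        ∑' y : ℕ, mainPart w 1 t (-m) (p * q) s ((y + 1 : ℕ) : ℤ) +
        ∑' y : ℕ, besselPart w 1 t (-m) (p * q) s ((y + 1 : ℕ) : ℤ) := by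
    intro s hs
    have hs' : 1 < (s : ℂ).re := by simpa using hs
    have hs2 : 1 < (2 * (s : ℂ)).re := by simp; linarith
    obtain ⟨-, -, hid⟩ := LSeries_mul_LSeries_eq h2 hodd b hb hω hD hp2 hq2 hpq hDp hDq hs'
    rw [DirichletCharacter.LFunction_eq_LSeries ψ hs', DirichletCharacter.LFunction_eq_LSeries χ' hs',
      DirichletCharacter.LFunction_eq_LSeries _ hs2]
    rw [show (LSeries (fun n => χ' n) (s : ℂ)) = LSeries (fun n => ψ n * jacobiChar (NumberField.discr K).natAbs n) s
      from LSeries_congr (fun {n} _ => (hprod n).symm) _,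
      show LSeries (fun n => (1 : DirichletCharacter ℂ (p * q)) n) (2 * (s : ℂ)) = LSeries (fun n => ψ n ^ 2) (2 * s)
      from LSeries_congr (fun {n} _ => (jacobiChar_sq_natCast n).symm) _]
    exact hid
  -- limits as `s → 1⁺`
  have hc := lineCharSum_jacobiChar hp2 hq2 hpq hDp hDq (t := t) (m := m)
  have hM := tendsto_tsum_mainPart hpos hp0 hq0 hcop (w := w) (fun y => hc _)
  have hB := tendsto_tsum_besselPart hpos hk hw
  have hofReal : Tendsto (fun s : ℝ => (s : ℂ)) (𝓝[>] 1) (𝓝 1) := by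
    have := (Complex.continuous_ofReal.tendsto (1 : ℝ)).mono_left (nhdsWithin_le_nhds (s := Set.Ioi (1 : ℝ)))
    simpa using this
  have hL1 : Tendsto (fun s : ℝ => ψ.LFunction s * χ'.LFunction s) (𝓝[>] 1)
      (𝓝 (ψ.LFunction 1 * χ'.LFunction 1)) :=
    ((DirichletCharacter.differentiable_LFunction hψ).continuous.tendsto 1 |>.comp hofReal).mul
      ((DirichletCharacter.differentiable_LFunction hχ'ne).continuous.tendsto 1 |>.comp hofReal)
  have hL2 : Tendsto (fun s : ℝ => (1 : DirichletCharacter ℂ (p * q)).LFunction (2 * s)) (𝓝[>] 1)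
      (𝓝 ((1 : DirichletCharacter ℂ (p * q)).LFunction 2)) := by
    have hc2 : ContinuousAt (1 : DirichletCharacter ℂ (p * q)).LFunction 2 :=
      (DirichletCharacter.differentiableAt_LFunction _ 2 (Or.inl (by norm_num))).continuousAt
    have h2s : Tendsto (fun s : ℝ => (2 : ℂ) * (s : ℂ)) (𝓝[>] 1) (𝓝 2) := by
      have := hofReal.const_mul (2 : ℂ)
      simpa using this
    exact hc2.tendsto.comp h2s
  have hRHS := (hL2.add hM).add hB
  rw [add_zero] at hRHS
  have hEq : (fun s : ℝ => ψ.LFunction s * χ'.LFunction s) =ᶠ[𝓝[>] 1]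
      fun s : ℝ => (1 : DirichletCharacter ℂ (p * q)).LFunction (2 * s) +
        ∑' y : ℕ, mainPart w 1 t (-m) (p * q) s ((y + 1 : ℕ) : ℤ) +
        ∑' y : ℕ, besselPart w 1 t (-m) (p * q) s ((y + 1 : ℕ) : ℤ) := by
    filter_upwards [self_mem_nhdsWithin] with s hs
    exact heq s hs
  exact tendsto_nhds_unique (hL1.congr' hEq) hRHS

/-- **The explicit constants**: `L(2, 𝟙_{pq}) = (1 − p^{−2})(1 − q^{−2}) π²/6`, and for `a = 1`,
`ω² = m + tω`: `κ = √(−(t² + 4m))/2 = √|d_K|/2`, so that the bound of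
`norm_tsum_besselPart_one_le_of_le_half` reads `|Σ_y besselPart_y(1)| ≤ (16π/√|d_K|) e^{−π√|d_K|/(pq)}`.
[cite: Baker1975, Ch. 5 §4] -/
theorem LFunction_one_two_eq {p q : ℕ} [Fact p.Prime] [Fact q.Prime] (hpq : p ≠ q) :
    haveI : NeZero (p * q) := ⟨mul_ne_zero (Fact.out : p.Prime).ne_zero (Fact.out : q.Prime).ne_zero⟩
    (1 : DirichletCharacter ℂ (p * q)).LFunction 2 =
      (1 - (p : ℂ) ^ (-(2 : ℂ))) * (1 - (q : ℂ) ^ (-(2 : ℂ))) * ((π : ℂ) ^ 2 / 6) := by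
  haveI : NeZero (p * q) := ⟨mul_ne_zero (Fact.out : p.Prime).ne_zero (Fact.out : q.Prime).ne_zero⟩
  have h := DirichletCharacter.LFunctionTrivChar_eq_mul_riemannZeta (N := p * q) (s := 2) (by norm_num)
  rw [DirichletCharacter.LFunctionTrivChar] at h
  rw [h, riemannZeta_two, Nat.primeFactors_mul (Fact.out : p.Prime).ne_zero (Fact.out : q.Prime).ne_zero,
    (Fact.out : p.Prime).primeFactors, (Fact.out : q.Prime).primeFactors,
    Finset.prod_union (Finset.disjoint_singleton.mpr hpq), Finset.prod_singleton, Finset.prod_singleton]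

/-- `κ = √|d_K|/2` for the form `x² + txy − my²` (`a = 1`). [folklore] -/
theorem starkK_one (t m : ℤ) : starkK 1 (t : ℝ) (-m : ℝ) = Real.sqrt (-(t ^ 2 + 4 * m : ℤ)) / 2 := by
  unfold starkK
  congr 1
  · congr 1; push_cast; ring
  · ring

end Limit

end Literature.NumberTheory.QuadraticFields.BakerLimitFormula
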